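import Summits.NavierStokesRegularity.FluidComputer.PalasekTowerHostBump
import Summits.NavierStokesRegularity.FluidComputer.PalasekTowerHostProfiles
import Summits.NavierStokesRegularity.FluidComputer.PalasekTowerRegisterWindow

/-!
# Host preparation, VI: the registered numbers and the host fields (velocity, pressure, residual)

Cell `ns-blowup`, seat `ns-blowup-ecbridge-3` (g0); GROUP C «BRIDGE SUPPORT» of the route
`PalasekTowerBreakdown` (crux `EpisodeBaseG`, item stmt-NavierStokesRegularity-19179, BC3 stub
`host_preparation` = the tree Prop `RungG 0`). LABEL: E–C typing (KERNEL construction). WHAT THIS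
IS NOT: not Navier–Stokes evidence — an EXPLICIT prescribed smooth flow and its Navier–Stokes
residual; the residual is the schedule's FORCE (free before the first readout `τ₀ = 1`), so no
dynamics is claimed.

The level-`0` host on the wide-base rates (`N₀ = 256`, `Y₀ = 256^{1.3}`, `A₀ = 256^{2.3}`), at unit
viscosity:

  `u(t, x) = a(t) • bumpF(x) + b(t) • slab(x)`,  `p(t, x) = −b(t)² |slab x|² / 2`,

with `slab = packet λ (cutoff L)` (the cut-off strong-Beltrami packet of frequency `λ = freq = 512 =
2 N₀`, plateau `B(0, L)`), `bumpF = place θ c L_b` (the dilated bump field centred at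
`c = (2L + 2L_b + 1) e₀`, disjoint from the slab), `a = (Y₀ / M) · ramp` (rises to the speed floor
`Y₀` exactly at `t = 1` and stays), `b = (Y₀ / 2λ) · decay` (switched on just before `t = 1`, then the
exact viscous decay `e^{−λ²(t−1)}`). §1 registered numbers (`N₀ = 256`, `A₀ = N₀ Y₀`,
`N₀^{β−2} = Y₀/N₀`); §2 the amplitudes and profiles `aProf`, `bProf` with their values, signs and
derivative identities; §3 the fields `slab`, `bumpF`, `vel`, `pres` and the RESIDUAL `resid` (the
force the prescribed flow needs: `a' bumpF + a² (bumpF·∇)bumpF + a curl curl bumpF + (b' + λ²b) slab +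
b² R × slab + b (λ R + curl R)`, `R` the Beltrami defect), joint smoothness, and the SUPPORT
DICHOTOMY (every point is off the slab or off the bump; everything vanishes off `B̄(0, radius)`).

References: S. Palasek, arXiv:2605.13827 §3.3–§4 [cite: Palasek2026ElementaryModel, §4];
A. J. Majda, A. L. Bertozzi, *Vorticity and Incompressible Flow* (CUP 2002), §2.3.2
[cite: MajdaBertozziCUP2002, §2.3.2].
-/

noncomputable section

namespace Summit.NavierStokesRegularity.FluidComputer.PalasekTowerClayBridge.Host

open Real Set Function Filter Topology InnerProductSpace Metric
open scoped RealInnerProductSpace ContDiff Topology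

open Literature.Analysis.FluidPDE
open Literature.Analysis.FluidPDE.DistributionalToWeakCounterexample (θ θ_contDiff θ_hasCompactSupport
  θ_isDivFree)

/-- Local notation for physical space `ℝ³ = EuclideanSpace ℝ (Fin 3)`. -/
local notation "ℝ³" => EuclideanSpace ℝ (Fin 3)

/-! ## §1 Registered numbers of the wide base at level `0` -/

/-- `N₀ = 256` on the wide base. [folklore] -/
theorem wide_N_zero : TowerRates.wide.N 0 = 256 := by
  simp [TowerRates.N, TowerRates.wide]

/-- `Y₀ > 0`. [folklore] -/
theorem wide_Y_zero_pos : 0 < TowerRates.wide.Y 0 :=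
  Real.rpow_pos_of_pos (TowerRates.wide.N_pos 0) _

/-- `A₀ = N₀ · Y₀` (`A = N^β`, `Y = N^{β-1}`). [folklore] -/
theorem wide_A_zero_eq : TowerRates.wide.A 0 = TowerRates.wide.N 0 * TowerRates.wide.Y 0 := by
  show TowerRates.wide.N 0 ^ TowerRates.wide.β = TowerRates.wide.N 0 * TowerRates.wide.N 0 ^ (TowerRates.wide.β - 1)
  have hN : TowerRates.wide.N 0 ≠ 0 := (TowerRates.wide.N_pos 0).ne'
  conv_lhs => rw [show TowerRates.wide.β = (TowerRates.wide.β - 1) + 1 by ring]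
  rw [Real.rpow_add_one hN, mul_comm]

/-- `N₀^{β-2} = Y₀ / N₀`. [folklore] -/
theorem wide_rpow_β_sub_two :
    TowerRates.wide.N 0 ^ (TowerRates.wide.β - 2) = TowerRates.wide.Y 0 / TowerRates.wide.N 0 := by
  show _ = TowerRates.wide.N 0 ^ (TowerRates.wide.β - 1) / TowerRates.wide.N 0
  have hN : TowerRates.wide.N 0 ≠ 0 := (TowerRates.wide.N_pos 0).ne'
  rw [show TowerRates.wide.β - 2 = (TowerRates.wide.β - 1) - 1 by ring, Real.rpow_sub_one hN]

/-- **The frequency of the slab**: `λ = 512 = 2 N₀`. [folklore] -/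
def freq : ℝ := 512

/-- `λ = 2 N₀`. [folklore] -/
theorem freq_eq : freq = 2 * TowerRates.wide.N 0 := by rw [wide_N_zero]; norm_num [freq]

/-- `0 < λ`. [folklore] -/
theorem freq_pos : 0 < freq := by norm_num [freq]

/-- The switch-on length `δ = 1/(4λ²)`. [folklore] -/
def switchLen : ℝ := 1 / (4 * freq ^ 2)

/-- `0 < δ`. [folklore] -/
theorem switchLen_pos : 0 < switchLen := by unfold switchLen; have := freq_pos; positivity

/-- `δ < 1/2`. [folklore] -/
theorem switchLen_lt : switchLen < 1 / 2 := by norm_num [switchLen, freq]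

/-! ## §2 Amplitudes and time profiles -/

/-- **The slab amplitude** `b₀ = Y₀ / (2λ)` (plateau speed `b₀ λ = Y₀/2`). [folklore] -/
def ampSlab : ℝ := TowerRates.wide.Y 0 / (2 * freq)

/-- **The bump amplitude** `a₀ = Y₀ / M` (`M` the maximal speed of `θ`; speed floor `a₀ M = Y₀`).
[folklore] -/
def ampBump : ℝ := TowerRates.wide.Y 0 / thetaMax

/-- `0 < b₀`. [folklore] -/
theorem ampSlab_pos : 0 < ampSlab := div_pos wide_Y_zero_pos (by have := freq_pos; positivity)

/-- `0 < a₀`. [folklore] -/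
theorem ampBump_pos : 0 < ampBump := div_pos wide_Y_zero_pos thetaMax_pos

/-- `a₀ M = Y₀`. [folklore] -/
theorem ampBump_mul_thetaMax : ampBump * thetaMax = TowerRates.wide.Y 0 :=
  div_mul_cancel₀ _ thetaMax_pos.ne'

/-- `b₀ λ = Y₀ / 2`. [folklore] -/
theorem ampSlab_mul_freq : ampSlab * freq = TowerRates.wide.Y 0 / 2 := by
  unfold ampSlab
  field_simp [freq_pos.ne']

/-- **The bump profile** `a = a₀ · ramp`. [folklore] -/
def aProf (t : ℝ) : ℝ := ampBump * ramp t

/-- **The slab profile** `b = b₀ · decay λ δ`. [folklore] -/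
def bProf (t : ℝ) : ℝ := ampSlab * decay freq switchLen t

/-- `a` is smooth. [folklore] -/
theorem contDiff_aProf : ContDiff ℝ ∞ aProf := contDiff_const.mul contDiff_ramp

/-- `b` is smooth. [folklore] -/
theorem contDiff_bProf : ContDiff ℝ ∞ bProf := contDiff_const.mul (contDiff_decay _ _)

/-- `a` is differentiable. [folklore] -/
theorem differentiable_aProf : Differentiable ℝ aProf := contDiff_aProf.differentiable (by simp)

/-- `b` is differentiable. [folklore] -/
theorem differentiable_bProf : Differentiable ℝ bProf := contDiff_bProf.differentiable (by simp)

/-- `a'` is smooth. [folklore] -/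
theorem contDiff_deriv_aProf : ContDiff ℝ ∞ (deriv aProf) := (contDiff_infty_iff_deriv.1 contDiff_aProf).2

/-- `b'` is smooth. [folklore] -/
theorem contDiff_deriv_bProf : ContDiff ℝ ∞ (deriv bProf) := (contDiff_infty_iff_deriv.1 contDiff_bProf).2

/-- `deriv a = a₀ · deriv ramp`. [folklore] -/
theorem deriv_aProf (t : ℝ) : deriv aProf t = ampBump * deriv ramp t := by
  show deriv (fun s => ampBump * ramp s) t = _
  rw [deriv_const_mul _ (differentiable_ramp t)]

/-- `deriv b = b₀ · deriv decay`. [folklore] -/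
theorem deriv_bProf (t : ℝ) : deriv bProf t = ampSlab * deriv (decay freq switchLen) t := by
  show deriv (fun s => ampSlab * decay freq switchLen s) t = _
  rw [deriv_const_mul _ (differentiable_decay _ _ t)]

/-- `a t = 0` for `t ≤ 0`. [folklore] -/
theorem aProf_of_nonpos {t : ℝ} (ht : t ≤ 0) : aProf t = 0 := by rw [aProf, ramp_of_nonpos ht, mul_zero]

/-- `a t = a₀` for `t ≥ 1`. [folklore] -/
theorem aProf_of_one_le {t : ℝ} (ht : 1 ≤ t) : aProf t = ampBump := by
  rw [aProf, ramp_of_one_le ht, mul_one]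

/-- `deriv a t = 0` for `t ≤ 0`. [folklore] -/
theorem deriv_aProf_of_nonpos {t : ℝ} (ht : t ≤ 0) : deriv aProf t = 0 := by
  rw [deriv_aProf, deriv_ramp_of_nonpos ht, mul_zero]

/-- `deriv a t = 0` for `t ≥ 1`. [folklore] -/
theorem deriv_aProf_of_one_le {t : ℝ} (ht : 1 ≤ t) : deriv aProf t = 0 := by
  rw [deriv_aProf, deriv_ramp_of_one_le ht, mul_zero]

/-- `0 ≤ a t ≤ a₀`. [folklore] -/
theorem aProf_nonneg (t : ℝ) : 0 ≤ aProf t := mul_nonneg ampBump_pos.le (ramp_nonneg t)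

/-- `a t ≤ a₀`. [folklore] -/
theorem aProf_le (t : ℝ) : aProf t ≤ ampBump := mul_le_of_le_one_right ampBump_pos.le (ramp_le_one t)

/-- `a t < a₀` for `t < 1` (the speed floor is met FIRST at `t = 1`). [folklore] -/
theorem aProf_lt {t : ℝ} (ht : t < 1) : aProf t < ampBump :=
  mul_lt_of_lt_one_right ampBump_pos (ramp_lt_one ht)

/-- `b t = 0` for `t ≤ 1/2` (before the switch-on). [folklore] -/
theorem bProf_of_le_half {t : ℝ} (ht : t ≤ 1 / 2) : bProf t = 0 := by
  rw [bProf, decay_of_le switchLen_pos (by linarith [switchLen_lt]), mul_zero]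

/-- `deriv b t = 0` for `t < 1/2`. [folklore] -/
theorem deriv_bProf_of_lt_half {t : ℝ} (ht : t < 1 / 2) : deriv bProf t = 0 := by
  rw [deriv_bProf, deriv_decay_of_lt switchLen_pos (by linarith [switchLen_lt]), mul_zero]

/-- `b 1 = b₀`. [folklore] -/
theorem bProf_one : bProf 1 = ampSlab := by rw [bProf, decay_one switchLen_pos, mul_one]

/-- **Exact viscous decay of the slab amplitude**: `deriv b + λ² b = 0` from `t = 1` on. [folklore] -/
theorem deriv_bProf_add {t : ℝ} (ht : 1 ≤ t) : deriv bProf t + freq ^ 2 * bProf t = 0 := by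
  rw [deriv_bProf, bProf]
  have := deriv_decay_add (lam := freq) switchLen_pos ht
  calc ampSlab * deriv (decay freq switchLen) t + freq ^ 2 * (ampSlab * decay freq switchLen t)
      = ampSlab * (deriv (decay freq switchLen) t + freq ^ 2 * decay freq switchLen t) := by ring
    _ = 0 := by rw [this, mul_zero]

/-- `0 ≤ b`. [folklore] -/
theorem bProf_nonneg (t : ℝ) : 0 ≤ bProf t := mul_nonneg ampSlab_pos.le (decay_nonneg t)

/-- `b ≤ (3/2) b₀` everywhere. [folklore] -/
theorem bProf_le (t : ℝ) : bProf t ≤ 3 / 2 * ampSlab := by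
  rw [bProf, mul_comm (3 / 2 : ℝ)]
  exact mul_le_mul_of_nonneg_left (decay_le_three_halves freq_pos.ne' t) ampSlab_pos.le

/-- `b t ≤ b₀` from `t = 1` on. [folklore] -/
theorem bProf_le_amp {t : ℝ} (ht : 1 ≤ t) : bProf t ≤ ampSlab :=
  mul_le_of_le_one_right ampSlab_pos.le (decay_le_one ht)

/-! ## §3 The host fields -/

section Fields

variable (L Lb : ℝ)

/-- **The slab** `packet λ (cutoff L)`. [folklore] -/
def slab : ℝ³ → ℝ³ := packet freq (cutoff L)

/-- The slab's Beltrami defect. [folklore] -/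
def slabDefect : ℝ³ → ℝ³ := packetDefect freq (cutoff L)

/-- **The centre of the bump** `c = (2L + 2L_b + 1) e₀`. [folklore] -/
def center : ℝ³ := (2 * L + 2 * Lb + 1) • EuclideanSpace.single 0 1

/-- **The bump field** `place θ c L_b`. [folklore] -/
def bumpF : ℝ³ → ℝ³ := place θ (center L Lb) Lb

/-- **The radius of the ball carrying everything**: `2L + 4L_b + 2`. [folklore] -/
def radius : ℝ := 2 * L + 4 * Lb + 2

/-- **The host velocity** `u(t) = a(t) • bumpF + b(t) • slab`. [folklore] -/
def vel (t : ℝ) (x : ℝ³) : ℝ³ := aProf t • bumpF L Lb x + bProf t • slab L x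

/-- **The host pressure** `p(t) = −b(t)² |slab|² / 2` (Bernoulli pressure of the slab). [folklore] -/
def pres (t : ℝ) (x : ℝ³) : ℝ := -(bProf t ^ 2) * (‖slab L x‖ ^ 2 / 2)

/-- **The Navier–Stokes residual of the host** (unit viscosity):
`a' bumpF + a² (bumpF·∇)bumpF + a curl curl bumpF + (b' + λ²b) slab + b² R × slab + b (λR + curl R)`.
[folklore] -/
def resid (t : ℝ) (x : ℝ³) : ℝ³ :=
  deriv aProf t • bumpF L Lb x + aProf t ^ 2 • convect (bumpF L Lb) (bumpF L Lb) x +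
    aProf t • curl (curl (bumpF L Lb)) x +
    (deriv bProf t + freq ^ 2 * bProf t) • slab L x +
    bProf t ^ 2 • cross (slabDefect L x) (slab L x) +
    bProf t • (freq • slabDefect L x + curl (slabDefect L) x)

variable {L Lb}

/-- `‖c‖ = 2L + 2L_b + 1` (`L, L_b ≥ 0`). [folklore] -/
theorem norm_center (hL : 0 ≤ L) (hLb : 0 ≤ Lb) : ‖center L Lb‖ = 2 * L + 2 * Lb + 1 := by
  rw [center, norm_smul, PiLp.norm_single, norm_one, mul_one, Real.norm_eq_abs,
    abs_of_nonneg (by positivity)]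

/-- The slab is smooth. [folklore] -/
theorem contDiff_slab : ContDiff ℝ ∞ (slab L) := contDiff_packet (contDiff_cutoff L)

/-- The slab defect is smooth. [folklore] -/
theorem contDiff_slabDefect : ContDiff ℝ ∞ (slabDefect L) := contDiff_packetDefect (contDiff_cutoff L)

/-- The bump field is smooth. [folklore] -/
theorem contDiff_bumpF : ContDiff ℝ ∞ (bumpF L Lb) := contDiff_place θ_contDiff

/-- The slab is differentiable. [folklore] -/
theorem differentiable_slab : Differentiable ℝ (slab L) := contDiff_slab.differentiable (by simp)

/-- The bump field is differentiable. [folklore] -/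
theorem differentiable_bumpF : Differentiable ℝ (bumpF L Lb) := contDiff_bumpF.differentiable (by simp)

/-- `(bumpF·∇)bumpF` is smooth. [folklore] -/
theorem contDiff_convect_bumpF : ContDiff ℝ ∞ (convect (bumpF L Lb) (bumpF L Lb)) := by
  have h1 : ContDiff ℝ ∞ (fderiv ℝ (bumpF L Lb)) :=
    contDiff_bumpF.fderiv_right (m := ∞) (by exact_mod_cast le_rfl)
  exact h1.clm_apply contDiff_bumpF

/-- `curl curl bumpF` is smooth. [folklore] -/
theorem contDiff_curl_curl_bumpF : ContDiff ℝ ∞ (curl (curl (bumpF L Lb))) :=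
  contDiff_curl (n := ⊤) ((contDiff_curl (n := ⊤)
    (contDiff_bumpF.of_le (by exact_mod_cast le_top))).of_le (by exact_mod_cast le_top))

/-- `curl R` is smooth. [folklore] -/
theorem contDiff_curl_slabDefect : ContDiff ℝ ∞ (curl (slabDefect L)) :=
  contDiff_curl (n := ⊤) (contDiff_slabDefect.of_le (by exact_mod_cast le_top))

/-- `R × slab` is smooth. [folklore] -/
theorem contDiff_cross_slab : ContDiff ℝ ∞ fun x => cross (slabDefect L x) (slab L x) := by
  have h : ContDiff ℝ ∞ fun x => crossCLM (slabDefect L x) (slab L x) :=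
    (crossCLM.contDiff.comp contDiff_slabDefect).clm_apply contDiff_slab
  simpa only [crossCLM_apply] using h

/-- **The velocity is jointly smooth on `ℝ × ℝ³`.** [folklore] -/
theorem contDiff_uncurry_vel : ContDiff ℝ ∞ (uncurry (vel L Lb)) :=
  ((contDiff_aProf.comp contDiff_fst).smul (contDiff_bumpF.comp contDiff_snd)).add
    ((contDiff_bProf.comp contDiff_fst).smul (contDiff_slab.comp contDiff_snd))

/-- **The pressure is jointly smooth on `ℝ × ℝ³`.** [folklore] -/
theorem contDiff_uncurry_pres : ContDiff ℝ ∞ (uncurry (pres L)) :=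
  ((contDiff_bProf.comp contDiff_fst).pow 2).neg.mul
    (((contDiff_slab.comp contDiff_snd).norm_sq ℝ).div_const 2)

/-- **The residual is jointly smooth on `ℝ × ℝ³`.** [folklore] -/
theorem contDiff_uncurry_resid : ContDiff ℝ ∞ (uncurry (resid L Lb)) := by
  show ContDiff ℝ ∞ fun p : ℝ × ℝ³ => resid L Lb p.1 p.2
  unfold resid
  refine ((((ContDiff.add ?_ ?_).add ?_).add ?_).add ?_).add ?_
  · exact (contDiff_deriv_aProf.comp contDiff_fst).smul (contDiff_bumpF.comp contDiff_snd)
  · exact ((contDiff_aProf.comp contDiff_fst).pow 2).smul (contDiff_convect_bumpF.comp contDiff_snd)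
  · exact (contDiff_aProf.comp contDiff_fst).smul (contDiff_curl_curl_bumpF.comp contDiff_snd)
  · exact ((contDiff_deriv_bProf.comp contDiff_fst).add
      (contDiff_const.mul (contDiff_bProf.comp contDiff_fst))).smul (contDiff_slab.comp contDiff_snd)
  · exact ((contDiff_bProf.comp contDiff_fst).pow 2).smul (contDiff_cross_slab.comp contDiff_snd)
  · exact (contDiff_bProf.comp contDiff_fst).smul
      ((contDiff_slabDefect.const_smul freq).add contDiff_curl_slabDefect |>.comp contDiff_snd)

/-! ### The support dichotomy -/

/-- `tsupport (curl v) ⊆ tsupport v`. [folklore] -/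
theorem tsupport_curl_subset (v : ℝ³ → ℝ³) : tsupport (curl v) ⊆ tsupport v := by
  refine closure_minimal (fun x hx => ?_) (isClosed_tsupport v)
  by_contra h
  exact hx (curl_eq_zero_of_notMem_tsupport h)

/-- `tsupport (curl curl θ) ⊆ B̄(0, 2)`. [folklore] -/
theorem tsupport_curl_curl_theta_subset : tsupport (curl (curl θ)) ⊆ Metric.closedBall (0 : ℝ³) 2 :=
  ((tsupport_curl_subset _).trans (tsupport_curl_subset _)).trans tsupport_theta_subset

/-- **Off the slab** (`‖x‖ > 2L`, `L > 0`): the slab, its Jacobian, its defect and the defect's curl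
vanish. [folklore] -/
theorem slab_zero (hL : 0 < L) {x : ℝ³} (hx : 2 * L < ‖x‖) :
    slab L x = 0 ∧ fderiv ℝ (slab L) x = 0 ∧ slabDefect L x = 0 ∧ curl (slabDefect L) x = 0 := by
  have hχ := notMem_tsupport_cutoff hL hx
  have hsm := contDiff_cutoff L
  refine ⟨packet_eq_zero (differentiable_cutoff L) hχ, ?_, packetDefect_eq_zero hsm hχ,
    curl_packetDefect_eq_zero hsm hχ⟩
  exact fderiv_of_notMem_tsupport ℝ fun h =>
    hχ (tsupport_packet_subset (differentiable_cutoff L) h)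

/-- Points of `B̄(0, 2L)` are farther than `2L_b` from the centre. [folklore] -/
theorem far_from_center (hL : 0 ≤ L) (hLb : 0 ≤ Lb) {x : ℝ³} (hx : ‖x‖ ≤ 2 * L) :
    2 * Lb < ‖x - center L Lb‖ := by
  have h := norm_sub_norm_le (center L Lb) x
  rw [norm_center hL hLb, norm_sub_rev] at h
  linarith

/-- **Off the bump** (`‖x − c‖ > 2L_b`, `L_b > 0`): the bump field, its Jacobian, its self-advection
and its double curl vanish. [folklore] -/
theorem bump_zero (hLb : 0 < Lb) {x : ℝ³} (hx : 2 * Lb < ‖x - center L Lb‖) :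
    bumpF L Lb x = 0 ∧ fderiv ℝ (bumpF L Lb) x = 0 ∧ convect (bumpF L Lb) (bumpF L Lb) x = 0 ∧
      curl (curl (bumpF L Lb)) x = 0 := by
  have h1 : bumpF L Lb x = 0 := place_eq_zero tsupport_theta_subset hLb hx
  refine ⟨h1, fderiv_place_eq_zero theta_differentiable tsupport_theta_subset hLb hx,
    by rw [convect_apply, h1, map_zero], ?_⟩
  rw [bumpF, curl_curl_place θ_contDiff, place_eq_zero tsupport_curl_curl_theta_subset hLb hx, smul_zero]

/-- **The support dichotomy**: every point is off the slab or off the bump (`L, L_b > 0`). [folklore] -/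
theorem off_slab_or_off_bump (hL : 0 < L) (hLb : 0 < Lb) (x : ℝ³) :
    2 * L < ‖x‖ ∨ 2 * Lb < ‖x - center L Lb‖ := by
  rcases lt_or_ge (2 * L) ‖x‖ with h | h
  · exact Or.inl h
  · exact Or.inr (far_from_center hL.le hLb.le h)

/-- **Outside the carrying ball both pieces vanish** (`‖x‖ > radius`). [folklore] -/
theorem far_both (hL : 0 < L) (hLb : 0 < Lb) {x : ℝ³} (hx : radius L Lb < ‖x‖) :
    2 * L < ‖x‖ ∧ 2 * Lb < ‖x - center L Lb‖ := by
  have hr : radius L Lb = 2 * L + 4 * Lb + 2 := rfl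
  refine ⟨by linarith, ?_⟩
  have h := norm_sub_norm_le x (center L Lb)
  rw [norm_center hL.le hLb.le] at h
  linarith

/-- **The residual vanishes outside the carrying ball.** [folklore] -/
theorem resid_eq_zero_of_far (hL : 0 < L) (hLb : 0 < Lb) {x : ℝ³} (hx : radius L Lb < ‖x‖) (t : ℝ) :
    resid L Lb t x = 0 := by
  obtain ⟨hxs, hxb⟩ := far_both hL hLb hx
  obtain ⟨hs0, -, hd0, hcd0⟩ := slab_zero hL hxs
  obtain ⟨hb0, -, -, hcc0⟩ := bump_zero (L := L) hLb hxb
  simp [resid, hs0, hd0, hcd0, hb0, hcc0, cross]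

/-- The velocity vanishes outside the carrying ball. [folklore] -/
theorem vel_eq_zero_of_far (hL : 0 < L) (hLb : 0 < Lb) {x : ℝ³} (hx : radius L Lb < ‖x‖) (t : ℝ) :
    vel L Lb t x = 0 := by
  obtain ⟨hxs, hxb⟩ := far_both hL hLb hx
  rw [vel, (slab_zero hL hxs).1, (bump_zero (L := L) hLb hxb).1, smul_zero, smul_zero, add_zero]

/-- **The residual vanishes before `t = 0`** (both profiles and their derivatives are `0` there).
[folklore] -/
theorem resid_eq_zero_of_nonpos {t : ℝ} (ht : t ≤ 0) (x : ℝ³) : resid L Lb t x = 0 := by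
  have h1 := aProf_of_nonpos ht
  have h2 := deriv_aProf_of_nonpos ht
  have h3 := bProf_of_le_half (by linarith : t ≤ 1 / 2)
  have h4 := deriv_bProf_of_lt_half (by linarith : t < 1 / 2)
  simp [resid, h1, h2, h3, h4]

end Fields

end Summit.NavierStokesRegularity.FluidComputer.PalasekTowerClayBridge.Host

end
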